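import Literature.MathematicalPhysics.QuantumFieldTheory.Balaban1983to89.B9TorusCalculus

/-!
# `Balaban1983to89.B11Eq138Polarization` — T. Bałaban, *The variational problem and background fields in renormalization group method for lattice gauge theories*, Commun. Math. Phys. **102** (1985) 277–309 [Balaban1985Variational]: (138) p. 299 — «2⟨A, Δ′_πHB⟩ = ⟨i[(G′RD*A)(b₋) + R_b(G′RD*A)(b₊), (HB)(b)], J⟩», the polarization of the gauge-defect form `⟨A, Δ′_πA⟩` of [5] (3.120) against a field annihilated by `RD*`, PROVED letter for letter on the lattice calculus of `B9Eq3117Current` (two bookkeeping definitions with bodies + theorems)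

statement-level skeleton of published theorems with citation tags; proofs where landed; nothing here is a claim about the Yang–Mills mass gap

PDF held: `paper:balaban1985-cmp102-variational-background` (journal page = PDF page + 276); p. 299 [PDF 23] render
`run/shared/lean/pub/pub-balaban/b2b-balaban-ref1/pages/1985-cmp102-variational-background/…-p023-x2.png` READ AS IMAGE (lit-balaban
reader/typer r08, gen 5, 2026-08-21).

CITATION HEADER (lean-in-tree rule 2026-08-18).  WHAT IS REPRODUCED: SKELETON row `B11.Eq137` (= displays (137)–(140) pp. 298–299; HOME
`run/shared/lean/pub/lit-balaban/lit-balaban-r08/ROWS-B11.md`), its member **(138)** — so far «(138)–(140) absent: need [5] (3.120), (3.10),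
(3.49) carriers» ((137) is `B11Eq131Projection.eq137`, (140) is `B11Eq135Weitzenbock.eq140`).  Unit `lit-balaban-r08` (gen 5).  Siblings used
BY NAME (nothing re-declared): `B9Eq3117Current` (r06: the bracket `shiftJ` of [5] (3.117) and **(3.120)** `deltaPiPrime` = «⟨A, Δ′_πA⟩»,
`hessPi` = «⟨A, Δ_πA⟩» (3.119), `eq3120`), `B9Eq39Adjoint` (`bondPair` = the pairing (3.11), `J` = the current, `R`), `B9Eq310Hermitian`
(`deltaOp` = Δ of (3.10), `hessPair_add` = its polarization), `Beta.BackgroundVertices.ad` (`ad a m = am − ma`, the commutator «[·,·]»),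
`B9TorusCalculus` (tori of record).  [5] = T. Bałaban, *Propagators for lattice gauge theories in a background field*, Commun. Math. Phys.
**99** (1985) 389–434 [Balaban1985BackgroundPropagators].

THE PRINT (p. 299 [PDF 23], verbatim from the render).  «hence |Δ_πHB|_{(−3)} ≦ O(1)|B|. Above we have used the equality RD*H = 0. This
equality implies also that Δ′_πH simplifies essentially, where Δ_π = Δ − Δ′_π is defined by the formula (3.120) [5]. From this formula we get
  2⟨A, Δ′_πHB⟩ = ⟨i[(G′RD*A)(b₋) + R_b(G′RD*A)(b₊), (HB)(b)], J⟩,   (138)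
and G′RD* is a bounded operator in the norm |·|_{(1)}. The properties of HB and J imply the bound |Δ′_πHB|_{(−3)} ≦ O(1)|B|, hence
|ΔHB|_{(−3)} ≦ O(1)|B|. (139)»  [5] (3.120) p. 419: «⟨A, Δ_πA⟩ = ⟨A, ΔA⟩ − ⟨i[(G′RD*A)(b₋), A(b)] − i[A(b), R_b(G′RD*A)(b₊)]
− i[(G′RD*A)(b₋), (DG′RD*A)(b)], J⟩ = ⟨A, ΔA⟩ − ⟨A, Δ′_πA⟩. (3.120)».

DICTIONARY.  `Δ′_π` is DEFINED in [5] by its quadratic form (3.120); «2⟨A, Δ′_πF⟩» for two different fields is the associated symmetric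
bilinear form, i.e. the POLARIZATION `Q(A + F) − Q(A) − Q(F)` of `Q = ⟨·, Δ′_π·⟩` (`twoPolar`).  The operator `G′RD*` (bond fields → site
functions) is an arbitrary ADDITIVE map `P` here (r06's `deltaPiPrime … P`), and «RD*H = 0» enters as `P F = 0` for the field `F = HB`.
The right-hand side of (138) is the bond field `bracket138 P A F : b ↦ i[(PA)(b₋) + R_b(PA)(b₊), F(b)]` paired with `J` by (3.11).

WHAT THIS FILE PROVES (any complete normed ℂ-algebra `𝔸` with a tracial functional in the rôle of «tr», any finite lattice of
`B9Eq39Adjoint`, ARBITRARY background of units, every `η`, `d`).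
* §1 `twoPolar`, `bracket138`; the bracket of (3.117)/(3.120) is affine in the field: `shiftJ_add_right`, and vanishes at `λ = 0`:
  `shiftJ_zero_left`; the cross term IS the printed bracket of (138): `cross_eq_bracket138` (`−i[F(b), R_bλ(b₊)] = i[R_bλ(b₊), F(b)]`).
* §2 **(138) PROVED** (`eq138`): for every additive `P` with `P F = 0`,
  `twoPolar ⟨·,Δ′_π·⟩ A F = ⟨bracket138 P A F, J⟩` — «2⟨A, Δ′_πHB⟩ = ⟨i[(G′RD*A)(b₋) + R_b(G′RD*A)(b₊), (HB)(b)], J⟩» with `F = HB`.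
* §3 the same for `Δ_π = Δ − Δ′_π` ((3.119)–(3.120), commuting shifts, `η ≠ 0`, continuous tracial `τ`): `eq138_deltaPi` —
  `twoPolar ⟨·,Δ_π·⟩ A F = 2⟨A, ΔF⟩ − ⟨bracket138 P A F, J⟩` («Δ′_πH simplifies essentially»); tori of record `eq138_deltaPi_torus`.

NOT PROVED HERE, NOT CLAIMED: the bounds (139) (they rest on [5] Thm 3.12/3.13 for `HB`, (3.36) for `J` and the boundedness of `G′RD*` in
`|·|_{(1)}` — typed B9 rows); anything about `H`, `G′`, `R` beyond additivity of `P` and `P(HB) = 0`.  NOT summit progress.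
-/

noncomputable section

open Complex

namespace Literature.MathematicalPhysics.QuantumFieldTheory.Balaban1983to89.B11Eq138Polarization

open Literature.MathematicalPhysics.QuantumFieldTheory.Balaban1983to89
open Literature.MathematicalPhysics.QuantumFieldTheory.Balaban1983to89.B9Eq39Adjoint
open Literature.MathematicalPhysics.QuantumFieldTheory.Balaban1983to89.B9Eq3117Current (shiftJ deltaPiPrime hessPi eq3120
  covDη covDη_apply)
open Literature.MathematicalPhysics.QuantumFieldTheory.Balaban1983to89.Beta.BackgroundVertices (ad ad_apply ad_add_left
  ad_add_right)

/-! ## §1  The polarization and the bracket of (138) -/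

section Polar

variable {𝔸 : Type*} [NormedRing 𝔸] {S : Type*} {ι : Type*}

/-- «2⟨A, Q F⟩» for a functional given by its QUADRATIC FORM `Q` (as `Δ′_π` is by (3.120) of [5]): the polarization
`Q(A + F) − Q(A) − Q(F)` (= twice the associated symmetric bilinear form when `Q` is quadratic). [cite: Balaban1985Variational, (138) p.299] -/
def twoPolar (Q : (ι → S → 𝔸) → ℂ) (A F : ι → S → 𝔸) : ℂ := Q (A + F) - Q A - Q F

/-- Unfolding `twoPolar`. [cite: Balaban1985Variational, (138) p.299] -/
theorem twoPolar_def (Q : (ι → S → 𝔸) → ℂ) (A F : ι → S → 𝔸) : twoPolar Q A F = Q (A + F) - Q A - Q F := rfl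

end Polar

section Defs

variable {𝔸 : Type*} [NormedRing 𝔸] [NormedAlgebra ℂ 𝔸]
variable {S : Type*} {ι : Type*}
variable (T : ι → Equiv.Perm S) (U : ι → S → 𝔸ˣ)

/-- **The bond field of (138)**: `b ↦ i[(PA)(b₋) + R_b(PA)(b₊), F(b)]` for a site function `λ = PA` (print: `λ = G′RD*A`) and a bond field
`F` (print: `F = HB`); `R_b = R(U(b))` transports `λ(b₊)` to `b₋`. [cite: Balaban1985Variational, (138) p.299] -/
def bracket138 (lam : S → 𝔸) (F : ι → S → 𝔸) : ι → S → 𝔸 := fun μ x =>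
  I • ad (lam x + R (U μ x) (lam (T μ x))) (F μ x)

/-- Unfolding `bracket138`. [cite: Balaban1985Variational, (138) p.299] -/
theorem bracket138_apply (lam : S → 𝔸) (F : ι → S → 𝔸) (μ : ι) (x : S) :
    bracket138 T U lam F μ x = I • ad (lam x + R (U μ x) (lam (T μ x))) (F μ x) := rfl

/-- The bracket `S_λ(A) = i[λ(b₋), A(b)] − i[A(b), R_bλ(b₊)] − i[λ(b₋), (Dλ)(b)]` of [5] (3.117)/(3.120) is AFFINE in the field:
`S_λ(A + F) = S_λ(A) + (i[λ(b₋), F(b)] − i[F(b), R_bλ(b₊)])`. [cite: Balaban1985Variational, (138) p.299] -/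
theorem shiftJ_add_right (η : ℝ) (lam : S → 𝔸) (A F : ι → S → 𝔸) :
    shiftJ T U η lam (A + F)
      = shiftJ T U η lam A + fun μ x => I • ad (lam x) (F μ x) - I • ad (F μ x) (R (U μ x) (lam (T μ x))) := by
  funext μ x
  simp only [shiftJ, Pi.add_apply, ad_add_right, ad_add_left, smul_add]
  abel

/-- … and vanishes at `λ = 0`: `S_0(F) = 0` (every commutator with `0`). [cite: Balaban1985Variational, (138) p.299] -/
theorem shiftJ_zero_left (η : ℝ) (F : ι → S → 𝔸) : shiftJ T U η (0 : S → 𝔸) F = 0 := by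
  funext μ x
  simp [shiftJ, covDη_apply, covD]

/-- The cross term IS the printed bracket: `i[λ(b₋), F(b)] − i[F(b), R_bλ(b₊)] = i[λ(b₋) + R_bλ(b₊), F(b)]`.
[cite: Balaban1985Variational, (138) p.299] -/
theorem cross_eq_bracket138 (lam : S → 𝔸) (F : ι → S → 𝔸) :
    (fun μ x => I • ad (lam x) (F μ x) - I • ad (F μ x) (R (U μ x) (lam (T μ x)))) = bracket138 T U lam F := by
  funext μ x
  simp only [bracket138, ad_apply, add_mul, mul_add, smul_sub, smul_add]
  abel

variable [Fintype S] [Fintype ι]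

/-- `⟨0, E⟩ = 0` for the pairing (3.11). [cite: Balaban1985BackgroundPropagators, (3.11) p.392] -/
theorem bondPair_zero_left (η : ℝ) (d : ℕ) (τ : 𝔸 →ₗ[ℂ] ℂ) (E : ι → S → 𝔸) : bondPair η d τ 0 E = 0 := by
  simp [bondPair]

end Defs

/-! ## §2  (138): `2⟨A, Δ′_πF⟩ = ⟨i[(PA)(b₋) + R_b(PA)(b₊), F(b)], J⟩` whenever `P F = 0` -/

section Eq138

variable {𝔸 : Type*} [NormedRing 𝔸] [NormedAlgebra ℂ 𝔸]
variable {S : Type*} [Fintype S] {ι : Type*} [Fintype ι] [LinearOrder ι]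
variable (T : ι → Equiv.Perm S) (U : ι → S → 𝔸ˣ)

/-- **(138) p. 299 PROVED**: «2⟨A, Δ′_πHB⟩ = ⟨i[(G′RD*A)(b₋) + R_b(G′RD*A)(b₊), (HB)(b)], J⟩» — for the gauge-defect form `⟨·, Δ′_π·⟩`
of [5] (3.120) (`B9Eq3117Current.deltaPiPrime`, with `G′RD*` an arbitrary ADDITIVE map `P` from bond fields to site functions) and any
bond field `F` with `P F = 0` («RD*H = 0», `F = HB`): `Q(A + F) − Q(A) − Q(F) = ⟨bracket138 P A F, J⟩`.  Every background of units,
every `η`, `d`, any ℂ-linear `τ` in the rôle of «tr»; no commuting of shifts needed. [cite: Balaban1985Variational, (138) p.299] -/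
theorem eq138 (η : ℝ) (d : ℕ) (τ : 𝔸 →ₗ[ℂ] ℂ) (P : (ι → S → 𝔸) → S → 𝔸) {A F : ι → S → 𝔸}
    (hPadd : P (A + F) = P A + P F) (hPF : P F = 0) :
    twoPolar (deltaPiPrime T U η d τ P) A F = bondPair η d τ (bracket138 T U (P A) F) (J T U η) := by
  rw [twoPolar, deltaPiPrime, deltaPiPrime, deltaPiPrime, hPadd, hPF, add_zero, shiftJ_add_right, shiftJ_zero_left,
    bondPair_zero_left, sub_zero, B9Eq310Hermitian.bondPair_add_left, cross_eq_bracket138, add_sub_cancel_left]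

/-- (138) for an additive-homomorphism `P` (e.g. a linear operator `G′RD*`), hypothesis `P F = 0` only. [cite: Balaban1985Variational, (138) p.299] -/
theorem eq138_of_addHom (η : ℝ) (d : ℕ) (τ : 𝔸 →ₗ[ℂ] ℂ) (P : (ι → S → 𝔸) →+ (S → 𝔸)) {A F : ι → S → 𝔸} (hPF : P F = 0) :
    twoPolar (deltaPiPrime T U η d τ P) A F = bondPair η d τ (bracket138 T U (P A) F) (J T U η) :=
  eq138 T U η d τ P (map_add P A F) hPF

end Eq138

/-! ## §3  The same for `Δ_π = Δ − Δ′_π` ((3.119)–(3.120)): `2⟨A, Δ_πF⟩ = 2⟨A, ΔF⟩ − ⟨bracket138, J⟩` -/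

section DeltaPi

variable {𝔸 : Type*} [NormedRing 𝔸] [NormedAlgebra ℂ 𝔸] [CompleteSpace 𝔸]
variable {S : Type*} [Fintype S] {ι : Type*} [Fintype ι] [LinearOrder ι]
variable (T : ι → Equiv.Perm S) (U : ι → S → 𝔸ˣ)

/-- «This equality implies also that Δ′_πH simplifies essentially, where Δ_π = Δ − Δ′_π is defined by the formula (3.120) [5]»: for the
gauge-invariant extension `⟨·, Δ_π·⟩` of (3.119) (`B9Eq3117Current.hessPi`) on a lattice with commuting shifts, a continuous tracial `τ` and
`η ≠ 0`, and `P`, `F` as in `eq138`:  `Q_π(A + F) − Q_π(A) − Q_π(F) = 2⟨A, ΔF⟩ − ⟨bracket138 P A F, J⟩` with `Δ` the operator (3.10)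
(`B9Eq310Hermitian.deltaOp`). [cite: Balaban1985Variational, (138) p.299] -/
theorem eq138_deltaPi (hT : ∀ μ ν x, T μ (T ν x) = T ν (T μ x)) (τ : 𝔸 →L[ℂ] ℂ) (hτ : ∀ a b : 𝔸, τ (a * b) = τ (b * a))
    {η : ℝ} (hη : η ≠ 0) (d : ℕ) (P : (ι → S → 𝔸) → S → 𝔸) {A F : ι → S → 𝔸}
    (hPadd : P (A + F) = P A + P F) (hPF : P F = 0) :
    twoPolar (hessPi T U η d (τ : 𝔸 →ₗ[ℂ] ℂ) P) A F
      = 2 * bondPair η d (τ : 𝔸 →ₗ[ℂ] ℂ) A (B9Eq310Hermitian.deltaOp T U η F)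
        - bondPair η d (τ : 𝔸 →ₗ[ℂ] ℂ) (bracket138 T U (P A) F) (J T U η) := by
  rw [twoPolar, eq3120 T U hT τ hτ hη d P, eq3120 T U hT τ hτ hη d P, eq3120 T U hT τ hτ hη d P,
    ← eq138 T U η d (τ : 𝔸 →ₗ[ℂ] ℂ) P hPadd hPF, twoPolar, B9Eq310Hermitian.hessPair_add T U (τ : 𝔸 →ₗ[ℂ] ℂ) hτ]
  ring

end DeltaPi

/-! ## §4  The tori of record -/

section Torus

variable {P₀ : Params} {j : ℕ}
variable {𝔸 : Type*} [NormedRing 𝔸] [NormedAlgebra ℂ 𝔸] [CompleteSpace 𝔸]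

/-- (138) in the `Δ_π` form on the torus `T^{(j)}` (`B9TorusCalculus.torusT`, commuting shifts discharged).
[cite: Balaban1985Variational, (138) p.299] -/
theorem eq138_deltaPi_torus (U : Fin P₀.d → Site P₀ j → 𝔸ˣ) (τ : 𝔸 →L[ℂ] ℂ) (hτ : ∀ a b : 𝔸, τ (a * b) = τ (b * a))
    {η : ℝ} (hη : η ≠ 0) (d : ℕ) (P : (Fin P₀.d → Site P₀ j → 𝔸) → Site P₀ j → 𝔸) {A F : Fin P₀.d → Site P₀ j → 𝔸}
    (hPadd : P (A + F) = P A + P F) (hPF : P F = 0) :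
    twoPolar (hessPi (B9TorusCalculus.torusT P₀ j) U η d (τ : 𝔸 →ₗ[ℂ] ℂ) P) A F
      = 2 * bondPair η d (τ : 𝔸 →ₗ[ℂ] ℂ) A (B9Eq310Hermitian.deltaOp (B9TorusCalculus.torusT P₀ j) U η F)
        - bondPair η d (τ : 𝔸 →ₗ[ℂ] ℂ) (bracket138 (B9TorusCalculus.torusT P₀ j) U (P A) F)
            (J (B9TorusCalculus.torusT P₀ j) U η) :=
  eq138_deltaPi _ U B9TorusCalculus.torusT_comm τ hτ hη d P hPadd hPF

end Torus

end Literature.MathematicalPhysics.QuantumFieldTheory.Balaban1983to89.B11Eq138Polarization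

end
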